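import Summits.BirchSwinnertonDyer.BirchSwinnertonDyer.Theses.AdditiveBranchIMC

/-!
# K1 route `AdditiveBranchIMC` — glue of the by-name alias split of `ReadingFacts`

Item `stmt-BirchSwinnertonDyer-19302` (support, glue of the gen-1 alias split E1 of the input support
`ReadingFacts`, stmt-BirchSwinnertonDyer-19361):
`ReadingFactsOfParts := WuthrichHalfEigenDivisibility → GreenbergVatsalResidualBranch →
GreenbergVatsalLiftingRamifiedEven → GreenbergVatsalLiftingEven → DelbourgoPotGoodOrdUnit → ReadingFacts`.

The five children are the five conjuncts of `ReadingFacts` BY NAME (each child's body is the cited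
Literature constant), so the glue is the anonymous constructor of a five-fold conjunction — the
planner's pre-flight `planner/k1-staffable/AliasSketch.lean` (`readingFactsOfParts_holds`, bsd-addord-plan
g13) landed verbatim against the route declarations. No mathematics is touched: the five Literature
facts stay exactly as unproved (and as audited: cell sheets `HOME/audit/D-AUDIT-19361-*.md`) as before.
-/

set_option autoImplicit false
set_option linter.dupNamespace false

namespace Summit.BirchSwinnertonDyer.BirchSwinnertonDyer.Theorems.AdditiveBranchIMCReadingFactsGlue

open Summit.BirchSwinnertonDyer.BirchSwinnertonDyer.Theses.AdditiveBranchIMC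

/-- **Glue item 19302, proved outright**: the five by-name conjuncts assemble to `ReadingFacts`. -/
theorem readingFactsOfParts_proof : ReadingFactsOfParts :=
  fun h1 h2 h3 h4 h5 ↦ ⟨h1, h2, h3, h4, h5⟩

end Summit.BirchSwinnertonDyer.BirchSwinnertonDyer.Theorems.AdditiveBranchIMCReadingFactsGlue
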